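import Literature.AlgebraicGeometry.Motives.TheoremOfCubeLimitProofs
import Literature.AlgebraicGeometry.Motives.PullbackOver
import Literature.AlgebraicGeometry.Motives.ProjectiveSpaceCells
import Literature.AlgebraicGeometry.FundamentalGroup.RiemannExistenceCovering
import Mathlib.AlgebraicGeometry.Morphisms.Finite
import Mathlib.AlgebraicGeometry.Morphisms.Etale
import HarnessLib

/-!
# Complex points of affine `ℂ`-schemes: points as algebra maps, fibre products, base change

Topic `Literature/AlgebraicGeometry/FundamentalGroup`. Point-set / functorial infrastructure for
the reduction of Riemann's existence theorem (SGA 1 XII Thm. 5.1, the named fact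
`riemannExistence_finiteCovering`) from a reduced affine base to a NORMAL affine base by patching
finite étale algebras over a conductor (Milnor) square (`Literature/RingTheory/Etale/
MilnorPatchingEtale.lean`, `Literature/Topology/PatchingHomeomorph.lean`). Everything here is about
the complex points `(Spec A)(ℂ)` (`Motives.ComplexPoints (specOver ℂ A)`, strong topology) of affine
`ℂ`-schemes:

* `exists_specOverOfAlgHom_eq`, `specOverOfAlgHom_injective`, `map_specOverOfAlgHom`,
  `specOverOfAlgHom_comp` — complex points of `Spec A` are exactly the `Spec ψ`, `ψ : A →ₐ[ℂ] ℂ`,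
  functorially (`Spec` is fully faithful);
* `exists_algEquiv_of_iso` — an isomorphism `Spec B₁ ≅ Spec B₂` over `Spec A` is `Spec` of an
  `A`-algebra isomorphism `B₂ ≃ₐ[A] B₁`;
* `pointsHomeomorphOfIso` — an isomorphism of `ℂ`-schemes gives a homeomorphism of complex points;
* `pullbackPointsHomeomorph` — `(X ×_S Y)(ℂ) ≃ₜ X(ℂ) ×_{S(ℂ)} Y(ℂ)` for `S` separated (the tree's
  `pullbackOver.pointsEquiv` / `isEmbedding_points` / `range_points` packaged as a homeomorphism);
* `specTensorIso`, `tensorPointsHomeomorph` (+ `_apply_fst/_snd`, `tensorPoints_ext`,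
  `exists_tensorPoint`) — `Spec (A ⊗_R B) ≅ Spec A ×_{Spec R} Spec B` over `ℂ` (Mathlib
  `pullbackSpecIso`) and the resulting description of `(Spec (A ⊗_R B))(ℂ)` as pairs of points;
* `algEquivOfIsBaseChange`, `specIsoOfIsBaseChange`, `baseChangePointsHomeomorph` (+ `_apply_fst/
  _snd`, `baseChangePoints_ext`, `exists_baseChangePoint`) — the same for an abstract base change
  `π : B → B₁`, `IsBaseChange R₁ π` (as produced by Milnor patching, `isBaseChange_patchFstHom`);
* `isFinite_left_specOverOfAlgHom(_toAlgHom)`, `etale_left_specOverOfAlgHom(_toAlgHom)`,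
  `isSeparated_specOver_hom`, `locallyOfFiniteType_specOver_hom` — instance transfer ring ⇒ scheme;
* `ringRiemannExistence_of_algEquiv` — Riemann existence in RING FORM («every finite-fibred
  covering of `(Spec R)(ℂ)` is `(Spec B)(ℂ)` for a finite étale `R`-algebra `B`», written out in
  full, no named predicate) is invariant under `ℂ`-algebra isomorphisms;
  `riemannExistence_specOver_of_ring` — ring form ⇒ covering (scheme) form for `Spec R`;
  `riemannExistence_of_iso` — the covering form is invariant under isomorphisms of `ℂ`-schemes.

All statements are proved; there are no named facts. Definitions: `pointsHomeomorphOfIso`,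
`pullbackPointsHomeomorph`, `tensorInl`, `tensorInr`, `specTensorIso`, `tensorPointsHomeomorph`,
`algEquivOfIsBaseChange`, `specIsoOfIsBaseChange`, `baseChangePointsHomeomorph`.

## References

* [SGA1] A. Grothendieck, M. Raynaud, *Revêtements étales et groupe fondamental (SGA 1)*,
  LNM 224 / arXiv:math/0206203, Exp. XII Thm. 5.1 and its proof, part 2 a) (p. 333 of the SMF
  edition; p0184 of the materialised text).
* [Hartshorne1977] R. Hartshorne, *Algebraic Geometry*, II.3 Thm. 3.3 (fibre products; affine case
  `Spec A ×_{Spec R} Spec B = Spec (A ⊗_R B)`).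
* [ConradAdelicPoints2012] B. Conrad, *Weil and Grothendieck approaches to adelic points*, Prop. 2.1
  (topology on points of fibre products).
* [Milnor1972] J. Milnor, *Introduction to algebraic K-theory*, §2 (patching over Milnor squares).

#harness_tags algebraic_geometry.sga1, hodge.stub_C1
-/

noncomputable section

open CategoryTheory CategoryTheory.Limits AlgebraicGeometry TensorProduct
open _root_.Topology

namespace Literature.AlgebraicGeometry.FundamentalGroup

open Literature.AlgebraicGeometry.Motives Literature.AlgebraicGeometry.Motives.AlgPoints

/-! ### Complex points of `Spec R` are `ℂ`-algebra homomorphisms `R → ℂ` -/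

section Points

variable {R S : Type} [CommRing R] [Algebra ℂ R] [CommRing S] [Algebra ℂ S]

/-- Every complex point of `Spec R` (over `ℂ`) is `Spec ψ` for a `ℂ`-algebra homomorphism
`ψ : R → ℂ` (`Spec` is fully faithful). [folklore] -/
theorem exists_specOverOfAlgHom_eq (P : Motives.ComplexPoints (specOver ℂ R)) :
    ∃ ψ : R →ₐ[ℂ] ℂ, specOverOfAlgHom ψ = P := by
  let ψ₀ : CommRingCat.of R ⟶ CommRingCat.of ℂ := Spec.preimage P.left
  have hw : Spec.map ψ₀ ≫ Spec.map (CommRingCat.ofHom (algebraMap ℂ R)) =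
      Spec.map (CommRingCat.ofHom (algebraMap ℂ ℂ)) := by
    rw [Spec.map_preimage]
    exact Over.w P
  rw [← Spec.map_comp, Spec.map_inj] at hw
  refine ⟨{ toRingHom := ψ₀.hom, commutes' := fun c ↦ ?_ }, ?_⟩
  · have := congrArg (fun f ↦ f.hom c) hw
    simpa using this
  · ext1
    change Spec.map (CommRingCat.ofHom ψ₀.hom) = P.left
    conv_rhs => rw [← Spec.map_preimage P.left]
    rfl

/-- `Spec` is faithful on complex points: `Spec ψ = Spec ψ'` only if `ψ = ψ'`. [folklore] -/
theorem specOverOfAlgHom_injective :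
    Function.Injective (specOverOfAlgHom : (R →ₐ[ℂ] ℂ) → Motives.ComplexPoints (specOver ℂ R)) := by
  intro ψ ψ' h
  have h' : Spec.map (CommRingCat.ofHom ψ.toRingHom) = Spec.map (CommRingCat.ofHom ψ'.toRingHom) :=
    congrArg (fun P : Motives.ComplexPoints (specOver ℂ R) ↦ P.left) h
  have h'' := Spec.map_injective h'
  ext r
  simpa using congrArg (fun f ↦ f.hom r) h''

/-- Functoriality: `(Spec φ)(Spec ψ) = Spec (ψ ∘ φ)` on complex points. [folklore] -/
theorem map_specOverOfAlgHom (φ : R →ₐ[ℂ] S) (ψ : S →ₐ[ℂ] ℂ) :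
    AlgPoints.map (specOverOfAlgHom φ) (specOverOfAlgHom ψ) = specOverOfAlgHom (ψ.comp φ) := by
  ext1
  change Spec.map _ ≫ Spec.map _ = Spec.map _
  rw [← Spec.map_comp]
  rfl

/-- `specOverOfAlgHom` is functorial. [folklore] -/
theorem specOverOfAlgHom_comp {T' : Type} [CommRing T'] [Algebra ℂ T'] (φ : R →ₐ[ℂ] S) (χ : S →ₐ[ℂ] T') :
    specOverOfAlgHom (χ.comp φ) = specOverOfAlgHom χ ≫ specOverOfAlgHom φ := by
  ext1
  change Spec.map _ = Spec.map _ ≫ Spec.map _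
  rw [← Spec.map_comp]
  rfl

end Points

/-! ### Isomorphisms of affine covers come from algebra isomorphisms -/

section AlgEquivOfIso

variable {A B₁ B₂ : Type} [CommRing A] [Algebra ℂ A] [CommRing B₁] [Algebra ℂ B₁] [Algebra A B₁]
  [IsScalarTower ℂ A B₁] [CommRing B₂] [Algebra ℂ B₂] [Algebra A B₂] [IsScalarTower ℂ A B₂]

/-- **An isomorphism `Spec B₁ ≅ Spec B₂` over `Spec A` is `Spec` of an `A`-algebra isomorphism
`θ : B₂ ≅ B₁`** (`Spec` fully faithful). [folklore] -/
theorem exists_algEquiv_of_iso (e : specOver ℂ B₁ ≅ specOver ℂ B₂)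
    (he : e.hom ≫ specOverOfAlgHom (IsScalarTower.toAlgHom ℂ A B₂) =
      specOverOfAlgHom (IsScalarTower.toAlgHom ℂ A B₁)) :
    ∃ θ : B₂ ≃ₐ[A] B₁, specOverOfAlgHom (θ.toAlgHom.restrictScalars ℂ) = e.hom := by
  let f : CommRingCat.of B₂ ⟶ CommRingCat.of B₁ := Spec.preimage e.hom.left
  let g : CommRingCat.of B₁ ⟶ CommRingCat.of B₂ := Spec.preimage e.inv.left
  have hgf : g ≫ f = 𝟙 _ := Spec.map_injective (by
    rw [Spec.map_comp, Spec.map_preimage, Spec.map_preimage, Spec.map_id]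
    exact congrArg (·.left) e.hom_inv_id)
  have hfg : f ≫ g = 𝟙 _ := Spec.map_injective (by
    rw [Spec.map_comp, Spec.map_preimage, Spec.map_preimage, Spec.map_id]
    exact congrArg (·.left) e.inv_hom_id)
  have hcomm : ∀ a : A, f.hom (algebraMap A B₂ a) = algebraMap A B₁ a := by
    have h1 : Spec.map (CommRingCat.ofHom (IsScalarTower.toAlgHom ℂ A B₂).toRingHom ≫ f) =
        Spec.map (CommRingCat.ofHom (IsScalarTower.toAlgHom ℂ A B₁).toRingHom) := by
      rw [Spec.map_comp, Spec.map_preimage]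
      exact congrArg (·.left) he
    have h2 := Spec.map_injective h1
    intro a
    simpa using congrArg (fun φ ↦ φ.hom a) h2
  let θ₀ : B₂ ≃+* B₁ :=
    { toFun := f.hom
      invFun := g.hom
      left_inv := fun b ↦ by
        change (f ≫ g).hom b = b
        rw [hfg]
        rfl
      right_inv := fun b ↦ by
        change (g ≫ f).hom b = b
        rw [hgf]
        rfl
      map_mul' := map_mul f.hom
      map_add' := map_add f.hom }
  refine ⟨AlgEquiv.ofRingEquiv (f := θ₀) hcomm, ?_⟩
  ext1
  change Spec.map f = e.hom.left
  exact Spec.map_preimage e.hom.left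

end AlgEquivOfIso

/-! ### Complex points along an isomorphism -/

section IsoPoints

variable {X Y : Motives.SchemeOver ℂ}

/-- An isomorphism of `ℂ`-schemes induces a homeomorphism of complex points. [folklore] -/
def pointsHomeomorphOfIso (e : X ≅ Y) : Motives.ComplexPoints X ≃ₜ Motives.ComplexPoints Y where
  toFun := AlgPoints.map e.hom
  invFun := AlgPoints.map e.inv
  left_inv P := by rw [← AlgPoints.map_comp_apply, e.hom_inv_id, AlgPoints.map_id_apply]
  right_inv Q := by rw [← AlgPoints.map_comp_apply, e.inv_hom_id, AlgPoints.map_id_apply]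
  continuous_toFun := AlgPoints.continuous_map e.hom
  continuous_invFun := AlgPoints.continuous_map e.inv

/-- Formula for `pointsHomeomorphOfIso`. [folklore] -/
@[simp] theorem pointsHomeomorphOfIso_apply (e : X ≅ Y) (P : Motives.ComplexPoints X) :
    pointsHomeomorphOfIso e P = AlgPoints.map e.hom P := rfl

/-- Formula for the inverse of `pointsHomeomorphOfIso`. [folklore] -/
@[simp] theorem pointsHomeomorphOfIso_symm_apply (e : X ≅ Y) (Q : Motives.ComplexPoints Y) :
    (pointsHomeomorphOfIso e).symm Q = AlgPoints.map e.inv Q := rfl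

end IsoPoints

/-! ### Complex points of fibre products -/

section PullbackPoints

variable {X Y S : Motives.SchemeOver ℂ} (f : X ⟶ S) (g : Y ⟶ S)

/-- **`(X ×_S Y)(ℂ) ≃ₜ X(ℂ) ×_{S(ℂ)} Y(ℂ)`** for `S` separated over `ℂ`: the pair-of-points bijection
`pullbackOver.pointsEquiv` is a homeomorphism onto the fibre product of the point spaces (it is a
topological embedding into `X(ℂ) × Y(ℂ)`, `pullbackOver.isEmbedding_points`).
[cite: ConradAdelicPoints2012, Prop. 2.1] -/
def pullbackPointsHomeomorph [IsSeparated S.hom] :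
    Motives.ComplexPoints (pullbackOver f g) ≃ₜ
      {p : Motives.ComplexPoints X × Motives.ComplexPoints Y //
        AlgPoints.map f p.1 = AlgPoints.map g p.2} :=
  (pullbackOver.pointsEquiv f g ℂ).toHomeomorphOfIsInducing
    (IsInducing.subtypeVal.of_comp_iff.mp (pullbackOver.isEmbedding_points f g ℂ).isInducing)

/-- First component of `pullbackPointsHomeomorph`. [folklore] -/
@[simp] theorem pullbackPointsHomeomorph_apply_fst [IsSeparated S.hom]
    (P : Motives.ComplexPoints (pullbackOver f g)) :
    ((pullbackPointsHomeomorph f g P).1).1 = AlgPoints.map (pullbackOver.fst f g) P := rfl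

/-- Second component of `pullbackPointsHomeomorph`. [folklore] -/
@[simp] theorem pullbackPointsHomeomorph_apply_snd [IsSeparated S.hom]
    (P : Motives.ComplexPoints (pullbackOver f g)) :
    ((pullbackPointsHomeomorph f g P).1).2 = AlgPoints.map (pullbackOver.snd f g) P := rfl

end PullbackPoints

/-! ### Complex points of `Spec (A ⊗_R B)` -/

section TensorPoints

variable (R A B : Type) [CommRing R] [Algebra ℂ R] [CommRing A] [Algebra ℂ A] [Algebra R A]
  [IsScalarTower ℂ R A] [CommRing B] [Algebra ℂ B] [Algebra R B] [IsScalarTower ℂ R B]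

/-- `A → A ⊗_R B`, `a ↦ a ⊗ 1`, as a `ℂ`-algebra map. [folklore] -/
abbrev tensorInl : A →ₐ[ℂ] A ⊗[R] B := Algebra.TensorProduct.includeLeft

/-- `B → A ⊗_R B`, `b ↦ 1 ⊗ b`, as a `ℂ`-algebra map. [folklore] -/
abbrev tensorInr : B →ₐ[ℂ] A ⊗[R] B :=
  (Algebra.TensorProduct.includeRight (R := R) (A := A) (B := B)).restrictScalars ℂ

/-- **`Spec (A ⊗_R B) ≅ Spec A ×_{Spec R} Spec B` over `ℂ`** (Mathlib's `pullbackSpecIso`).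
[cite: Hartshorne1977, II.3 Thm. 3.3] -/
def specTensorIso :
    specOver ℂ (A ⊗[R] B) ≅
      pullbackOver (specOverOfAlgHom (IsScalarTower.toAlgHom ℂ R A))
        (specOverOfAlgHom (IsScalarTower.toAlgHom ℂ R B)) :=
  Over.isoMk (pullbackSpecIso R A B).symm (by
    change (pullbackSpecIso R A B).inv ≫
        pullback.fst (Spec.map (CommRingCat.ofHom (algebraMap R A)))
          (Spec.map (CommRingCat.ofHom (algebraMap R B))) ≫
          Spec.map (CommRingCat.ofHom (algebraMap ℂ A)) =
      Spec.map (CommRingCat.ofHom (algebraMap ℂ (A ⊗[R] B)))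
    rw [pullbackSpecIso_inv_fst'_assoc, ← Spec.map_comp, ← CommRingCat.ofHom_comp,
      ← IsScalarTower.algebraMap_eq])

/-- `specTensorIso` followed by the first projection is `Spec (a ↦ a ⊗ 1)`. [folklore] -/
theorem specTensorIso_hom_fst :
    (specTensorIso R A B).hom ≫ pullbackOver.fst _ _ = specOverOfAlgHom (tensorInl R A B) := by
  ext1
  change (pullbackSpecIso R A B).inv ≫
      pullback.fst (Spec.map (CommRingCat.ofHom (algebraMap R A)))
        (Spec.map (CommRingCat.ofHom (algebraMap R B))) = _
  rw [pullbackSpecIso_inv_fst]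
  rfl

/-- `specTensorIso` followed by the second projection is `Spec (b ↦ 1 ⊗ b)`. [folklore] -/
theorem specTensorIso_hom_snd :
    (specTensorIso R A B).hom ≫ pullbackOver.snd _ _ = specOverOfAlgHom (tensorInr R A B) := by
  ext1
  change (pullbackSpecIso R A B).inv ≫
      pullback.snd (Spec.map (CommRingCat.ofHom (algebraMap R A)))
        (Spec.map (CommRingCat.ofHom (algebraMap R B))) = _
  rw [pullbackSpecIso_inv_snd]
  rfl

/-- **`(Spec (A ⊗_R B))(ℂ) ≃ₜ (Spec A)(ℂ) ×_{(Spec R)(ℂ)} (Spec B)(ℂ)`**: complex points of the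
tensor product are the pairs of complex points of the factors agreeing on `Spec R`,
homeomorphically for the strong topologies. [cite: ConradAdelicPoints2012, Prop. 2.1] -/
def tensorPointsHomeomorph :
    Motives.ComplexPoints (specOver ℂ (A ⊗[R] B)) ≃ₜ
      {p : Motives.ComplexPoints (specOver ℂ A) × Motives.ComplexPoints (specOver ℂ B) //
        AlgPoints.map (specOverOfAlgHom (IsScalarTower.toAlgHom ℂ R A)) p.1 =
          AlgPoints.map (specOverOfAlgHom (IsScalarTower.toAlgHom ℂ R B)) p.2} :=
  haveI : IsSeparated (specOver ℂ R).hom := by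
    change IsSeparated (Spec.map _)
    infer_instance
  (pointsHomeomorphOfIso (specTensorIso R A B)).trans (pullbackPointsHomeomorph _ _)

/-- First component of `tensorPointsHomeomorph`: restriction to `A`. [folklore] -/
@[simp] theorem tensorPointsHomeomorph_apply_fst (P : Motives.ComplexPoints (specOver ℂ (A ⊗[R] B))) :
    ((tensorPointsHomeomorph R A B P).1).1 = AlgPoints.map (specOverOfAlgHom (tensorInl R A B)) P := by
  rw [← specTensorIso_hom_fst, AlgPoints.map_comp_apply]
  rfl

/-- Second component of `tensorPointsHomeomorph`: restriction to `B`. [folklore] -/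
@[simp] theorem tensorPointsHomeomorph_apply_snd (P : Motives.ComplexPoints (specOver ℂ (A ⊗[R] B))) :
    ((tensorPointsHomeomorph R A B P).1).2 = AlgPoints.map (specOverOfAlgHom (tensorInr R A B)) P := by
  rw [← specTensorIso_hom_snd, AlgPoints.map_comp_apply]
  rfl

/-- Two complex points of `Spec (A ⊗_R B)` with the same restrictions to `A` and to `B` are equal.
[folklore] -/
theorem tensorPoints_ext {P Q : Motives.ComplexPoints (specOver ℂ (A ⊗[R] B))}
    (h₁ : AlgPoints.map (specOverOfAlgHom (tensorInl R A B)) P =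
      AlgPoints.map (specOverOfAlgHom (tensorInl R A B)) Q)
    (h₂ : AlgPoints.map (specOverOfAlgHom (tensorInr R A B)) P =
      AlgPoints.map (specOverOfAlgHom (tensorInr R A B)) Q) : P = Q := by
  apply (tensorPointsHomeomorph R A B).injective
  ext1
  exact Prod.ext (by simpa using h₁) (by simpa using h₂)

/-- Every compatible pair of complex points of `Spec A` and `Spec B` comes from a (unique) complex
point of `Spec (A ⊗_R B)`. [folklore] -/
theorem exists_tensorPoint (a : Motives.ComplexPoints (specOver ℂ A))
    (b : Motives.ComplexPoints (specOver ℂ B))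
    (h : AlgPoints.map (specOverOfAlgHom (IsScalarTower.toAlgHom ℂ R A)) a =
      AlgPoints.map (specOverOfAlgHom (IsScalarTower.toAlgHom ℂ R B)) b) :
    ∃ P : Motives.ComplexPoints (specOver ℂ (A ⊗[R] B)),
      AlgPoints.map (specOverOfAlgHom (tensorInl R A B)) P = a ∧
        AlgPoints.map (specOverOfAlgHom (tensorInr R A B)) P = b := by
  refine ⟨(tensorPointsHomeomorph R A B).symm ⟨(a, b), h⟩, ?_, ?_⟩
  · rw [← tensorPointsHomeomorph_apply_fst, Homeomorph.apply_symm_apply]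
  · rw [← tensorPointsHomeomorph_apply_snd, Homeomorph.apply_symm_apply]

end TensorPoints

/-! ### Finite / étale / separated / finite type for `Spec` of algebra maps -/

section SpecInstances

variable {A B : Type} [CommRing A] [Algebra ℂ A] [CommRing B] [Algebra ℂ B]

/-- `Spec φ` is finite for `φ` finite. [folklore] -/
theorem isFinite_left_specOverOfAlgHom (φ : A →ₐ[ℂ] B) (hφ : φ.toRingHom.Finite) :
    IsFinite (specOverOfAlgHom φ).left := by
  change @IsFinite (Spec (.of B)) (Spec (.of A)) (Spec.map (CommRingCat.ofHom φ.toRingHom))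
  rw [IsFinite.SpecMap_iff]
  exact hφ

/-- `Spec φ` is étale for `φ` étale. [folklore] -/
theorem etale_left_specOverOfAlgHom (φ : A →ₐ[ℂ] B) (hφ : φ.toRingHom.Etale) :
    Etale (specOverOfAlgHom φ).left := by
  change @Etale (Spec (.of B)) (Spec (.of A)) (Spec.map (CommRingCat.ofHom φ.toRingHom))
  rw [HasRingHomProperty.Spec_iff (P := @Etale)]
  exact hφ

/-- `Spec B → Spec A` is finite for `B` a finite `A`-algebra. [folklore] -/
theorem isFinite_left_specOverOfAlgHom_toAlgHom [Algebra A B] [IsScalarTower ℂ A B] [Module.Finite A B] :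
    IsFinite (specOverOfAlgHom (IsScalarTower.toAlgHom ℂ A B)).left :=
  isFinite_left_specOverOfAlgHom _ (RingHom.finite_algebraMap.mpr ‹_›)

/-- `Spec B → Spec A` is étale for `B` an étale `A`-algebra. [folklore] -/
theorem etale_left_specOverOfAlgHom_toAlgHom [Algebra A B] [IsScalarTower ℂ A B] [Algebra.Etale A B] :
    Etale (specOverOfAlgHom (IsScalarTower.toAlgHom ℂ A B)).left :=
  etale_left_specOverOfAlgHom _ ((RingHom.etale_algebraMap (R := A) (S := B)).mpr ‹_›)

variable (A) in
/-- `Spec A → Spec ℂ` is separated. [folklore] -/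
theorem isSeparated_specOver_hom : IsSeparated (specOver ℂ A).hom := by
  change IsSeparated (Spec.map _)
  infer_instance

variable (A) in
/-- `Spec A → Spec ℂ` is locally of finite type for `A` of finite type over `ℂ`. [folklore] -/
theorem locallyOfFiniteType_specOver_hom [Algebra.FiniteType ℂ A] :
    LocallyOfFiniteType (specOver ℂ A).hom := by
  change LocallyOfFiniteType (Spec.map _)
  rw [HasRingHomProperty.Spec_iff (P := @LocallyOfFiniteType)]
  exact RingHom.finiteType_algebraMap.mpr ‹_›

end SpecInstances

/-! ### Riemann existence in ring form: transport and comparison with the scheme form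

For a `ℂ`-algebra `R`, "Riemann existence in ring form for `R`" is the statement that every
finite-fibred covering space `q : T → (Spec R)(ℂ)` is `(Spec B)(ℂ)` over `(Spec R)(ℂ)` for a finite
étale `R`-algebra `B`. It is written out in full in each statement below (no named predicate). -/

section RingForm

variable {R R' : Type} [CommRing R] [Algebra ℂ R] [CommRing R'] [Algebra ℂ R']

/-- **Transport of Riemann existence (ring form) along a `ℂ`-algebra isomorphism.** [folklore] -/
theorem ringRiemannExistence_of_algEquiv (e : R ≃ₐ[ℂ] R')
    (h : ∀ (T : Type) [TopologicalSpace T] (q : T → Motives.ComplexPoints (specOver ℂ R)),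
      IsCoveringMap q → (∀ x, (q ⁻¹' {x}).Finite) →
      ∃ (B : Type) (_ : CommRing B) (_ : Algebra R B) (_ : Algebra ℂ B) (_ : IsScalarTower ℂ R B)
        (_ : Module.Finite R B) (_ : Algebra.Etale R B)
        (Φ : Motives.ComplexPoints (specOver ℂ B) ≃ₜ T),
        ∀ z, q (Φ z) = AlgPoints.map (specOverOfAlgHom (IsScalarTower.toAlgHom ℂ R B)) z) :
    ∀ (T : Type) [TopologicalSpace T] (q : T → Motives.ComplexPoints (specOver ℂ R')),
      IsCoveringMap q → (∀ x, (q ⁻¹' {x}).Finite) →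
      ∃ (B : Type) (_ : CommRing B) (_ : Algebra R' B) (_ : Algebra ℂ B) (_ : IsScalarTower ℂ R' B)
        (_ : Module.Finite R' B) (_ : Algebra.Etale R' B)
        (Φ : Motives.ComplexPoints (specOver ℂ B) ≃ₜ T),
        ∀ z, q (Φ z) = AlgPoints.map (specOverOfAlgHom (IsScalarTower.toAlgHom ℂ R' B)) z := by
  intro T _ q' hq' hfin'
  let ε : specOver ℂ R' ≅ specOver ℂ R := AffineLineProduct.specOverIsoOfAlgEquiv ℂ e
  let E : Motives.ComplexPoints (specOver ℂ R') ≃ₜ Motives.ComplexPoints (specOver ℂ R) :=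
    pointsHomeomorphOfIso ε
  let q : T → Motives.ComplexPoints (specOver ℂ R) := E ∘ q'
  have hq : IsCoveringMap q := hq'.homeomorph_comp E
  have hfin : ∀ x, (q ⁻¹' {x}).Finite := fun x ↦ by
    have : q ⁻¹' {x} = q' ⁻¹' {E.symm x} := by
      ext t
      simp only [q, Set.mem_preimage, Function.comp_apply, Set.mem_singleton_iff]
      rw [eq_comm (a := q' t), Homeomorph.symm_apply_eq, eq_comm]
    rw [this]
    exact hfin' _
  obtain ⟨B, _, _, _, _, _, _, Φ, hΦ⟩ := h T q hq hfin
  letI alg' : Algebra R' B := ((algebraMap R B).comp e.symm.toRingEquiv.toRingHom).toAlgebra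
  haveI : IsScalarTower ℂ R' B := IsScalarTower.of_algebraMap_eq fun c ↦ by
    change algebraMap ℂ B c = algebraMap R B (e.symm (algebraMap ℂ R' c))
    rw [AlgEquiv.commutes, ← IsScalarTower.algebraMap_apply]
  haveI : Module.Finite R' B := by
    rw [← RingHom.finite_algebraMap]
    change ((algebraMap R B).comp e.symm.toRingEquiv.toRingHom).Finite
    exact RingHom.Finite.comp (RingHom.finite_algebraMap.mpr ‹_›)
      (RingHom.Finite.of_surjective _ e.symm.toRingEquiv.surjective)
  haveI : Algebra.Etale R' B := by
    rw [← RingHom.etale_algebraMap]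
    change ((algebraMap R B).comp e.symm.toRingEquiv.toRingHom).Etale
    exact RingHom.Etale.stableUnderComposition _ _
      (RingHom.Etale.of_bijective e.symm.toRingEquiv.bijective)
      ((RingHom.etale_algebraMap (R := R) (S := B)).mpr ‹_›)
  refine ⟨B, inferInstance, alg', inferInstance, inferInstance, inferInstance, inferInstance, Φ,
    fun z ↦ ?_⟩
  have h1 : q' (Φ z) = E.symm (q (Φ z)) := by
    simp only [q, Function.comp_apply, Homeomorph.symm_apply_apply]
  rw [h1, hΦ, pointsHomeomorphOfIso_symm_apply, ← AlgPoints.map_comp_apply]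
  congr 1
  rw [Iso.comp_inv_eq]
  ext1
  change Spec.map (CommRingCat.ofHom (algebraMap R B)) =
    Spec.map (CommRingCat.ofHom (algebraMap R' B)) ≫
      Spec.map (CommRingCat.ofHom e.toRingEquiv.toRingHom)
  rw [← Spec.map_comp, ← CommRingCat.ofHom_comp]
  congr 2
  ext r
  change algebraMap R B r = algebraMap R B (e.symm (e r))
  rw [AlgEquiv.symm_apply_apply]

variable (R) in
/-- **Ring form ⇒ scheme form**: Riemann existence in ring form for `R` gives it in covering
form for the `ℂ`-scheme `Spec R`. [folklore] -/
theorem riemannExistence_specOver_of_ring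
    (h : ∀ (T : Type) [TopologicalSpace T] (q : T → Motives.ComplexPoints (specOver ℂ R)),
      IsCoveringMap q → (∀ x, (q ⁻¹' {x}).Finite) →
      ∃ (B : Type) (_ : CommRing B) (_ : Algebra R B) (_ : Algebra ℂ B) (_ : IsScalarTower ℂ R B)
        (_ : Module.Finite R B) (_ : Algebra.Etale R B)
        (Φ : Motives.ComplexPoints (specOver ℂ B) ≃ₜ T),
        ∀ z, q (Φ z) = AlgPoints.map (specOverOfAlgHom (IsScalarTower.toAlgHom ℂ R B)) z) :
    ∀ (T : Type) [TopologicalSpace T] (q : T → Motives.ComplexPoints (specOver ℂ R)),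
      IsCoveringMap q → (∀ x, (q ⁻¹' {x}).Finite) →
      ∃ (S' : Motives.SchemeOver ℂ) (g : S' ⟶ (specOver ℂ R)) (Φ : Motives.ComplexPoints S' ≃ₜ T),
        IsFinite g.left ∧ Etale g.left ∧ ∀ z, q (Φ z) = AlgPoints.map g z := by
  intro T _ q hq hfin
  obtain ⟨B, _, _, _, _, _, _, Φ, hΦ⟩ := h T q hq hfin
  exact ⟨specOver ℂ B, specOverOfAlgHom (IsScalarTower.toAlgHom ℂ R B), Φ,
    isFinite_left_specOverOfAlgHom_toAlgHom, etale_left_specOverOfAlgHom_toAlgHom, hΦ⟩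

end RingForm

/-! ### Transport of the scheme form along isomorphisms -/

section SchemeForm

variable {S₁ S₂ : Motives.SchemeOver ℂ}

/-- **Transport of Riemann existence (covering form) along an isomorphism of `ℂ`-schemes.**
[folklore] -/
theorem riemannExistence_of_iso (e : S₁ ≅ S₂)
    (h : ∀ (T : Type) [TopologicalSpace T] (q : T → Motives.ComplexPoints S₁),
      IsCoveringMap q → (∀ x, (q ⁻¹' {x}).Finite) →
      ∃ (S' : Motives.SchemeOver ℂ) (g : S' ⟶ S₁) (Φ : Motives.ComplexPoints S' ≃ₜ T),
        IsFinite g.left ∧ Etale g.left ∧ ∀ z, q (Φ z) = AlgPoints.map g z) :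
    ∀ (T : Type) [TopologicalSpace T] (q : T → Motives.ComplexPoints S₂),
      IsCoveringMap q → (∀ x, (q ⁻¹' {x}).Finite) →
      ∃ (S' : Motives.SchemeOver ℂ) (g : S' ⟶ S₂) (Φ : Motives.ComplexPoints S' ≃ₜ T),
        IsFinite g.left ∧ Etale g.left ∧ ∀ z, q (Φ z) = AlgPoints.map g z := by
  intro T _ q₂ hq₂ hfin₂
  let E : Motives.ComplexPoints S₁ ≃ₜ Motives.ComplexPoints S₂ := pointsHomeomorphOfIso e
  let q₁ : T → Motives.ComplexPoints S₁ := E.symm ∘ q₂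
  have hq₁ : IsCoveringMap q₁ := hq₂.homeomorph_comp E.symm
  have hfin₁ : ∀ x, (q₁ ⁻¹' {x}).Finite := fun x ↦ by
    have : q₁ ⁻¹' {x} = q₂ ⁻¹' {E x} := by
      ext t
      simp only [q₁, Set.mem_preimage, Function.comp_apply, Set.mem_singleton_iff]
      rw [Homeomorph.symm_apply_eq]
    rw [this]
    exact hfin₂ _
  obtain ⟨S', g, Φ, hg₁, hg₂, hΦ⟩ := h T q₁ hq₁ hfin₁
  haveI := hg₁
  haveI := hg₂
  haveI : IsIso e.hom.left := inferInstanceAs (IsIso ((Over.forget _).map e.hom))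
  refine ⟨S', g ≫ e.hom, Φ, ?_, ?_, fun z ↦ ?_⟩
  · rw [Over.comp_left]; infer_instance
  · rw [Over.comp_left]; infer_instance
  · have h1 : q₂ (Φ z) = E (q₁ (Φ z)) := by
      simp only [q₁, Function.comp_apply, Homeomorph.apply_symm_apply]
    rw [h1, hΦ, pointsHomeomorphOfIso_apply, ← AlgPoints.map_comp_apply]

end SchemeForm

/-! ### Complex points of a base change `B₁ ≅ R₁ ⊗_R B` -/

section BaseChangePoints

variable {R R₁ B B₁ : Type} [CommRing R] [CommRing R₁] [Algebra R R₁] [CommRing B] [Algebra R B]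
  [CommRing B₁] [Algebra R₁ B₁] [Algebra R B₁] [IsScalarTower R R₁ B₁]
  (π : B →ₐ[R] B₁) (hπ : IsBaseChange R₁ π.toLinearMap)

/-- The algebra isomorphism `R₁ ⊗_R B ≅ B₁` of a base change `π : B → B₁` (`IsBaseChange`),
`s ⊗ b ↦ s · π b` (cf. Mathlib's `Algebra.IsPushout.equiv`). [folklore] -/
def algEquivOfIsBaseChange : (R₁ ⊗[R] B) ≃ₐ[R₁] B₁ where
  __ := hπ.equiv
  map_mul' x y := by
    dsimp
    induction x with
    | zero => simp
    | add x y _ _ => simp [*, add_mul]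
    | tmul a b =>
      induction y with
      | zero => simp
      | add x y _ _ => simp [*, mul_add]
      | tmul x y =>
        simp only [Algebra.TensorProduct.tmul_mul_tmul, IsBaseChange.equiv_tmul,
          AlgHom.toLinearMap_apply, map_mul, Algebra.smul_def, mul_mul_mul_comm]
  commutes' s := by
    simp [Algebra.TensorProduct.algebraMap_apply, IsBaseChange.equiv_tmul, Algebra.smul_def]

/-- `algEquivOfIsBaseChange (s ⊗ b) = s · π b`. [folklore] -/
@[simp] theorem algEquivOfIsBaseChange_tmul (s : R₁) (b : B) :
    algEquivOfIsBaseChange π hπ (s ⊗ₜ b) = s • π b :=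
  hπ.equiv_tmul s b

variable [Algebra ℂ R] [Algebra ℂ R₁] [IsScalarTower ℂ R R₁] [Algebra ℂ B₁] [IsScalarTower ℂ R₁ B₁]

/-- The `ℂ`-isomorphism `Spec B₁ ≅ Spec (R₁ ⊗_R B)` of a base change. [folklore] -/
def specIsoOfIsBaseChange : specOver ℂ B₁ ≅ specOver ℂ (R₁ ⊗[R] B) :=
  AffineLineProduct.specOverIsoOfAlgEquiv ℂ ((algEquivOfIsBaseChange π hπ).restrictScalars ℂ)

/-- `Spec B₁ ≅ Spec (R₁ ⊗_R B) → Spec R₁` is the structure map. [folklore] -/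
theorem specIsoOfIsBaseChange_hom_inl :
    (specIsoOfIsBaseChange π hπ).hom ≫ specOverOfAlgHom (tensorInl R R₁ B) =
      specOverOfAlgHom (IsScalarTower.toAlgHom ℂ R₁ B₁) := by
  ext1
  change Spec.map (CommRingCat.ofHom ((algEquivOfIsBaseChange π hπ).restrictScalars ℂ).toRingEquiv.toRingHom) ≫
      Spec.map (CommRingCat.ofHom (tensorInl R R₁ B).toRingHom) =
    Spec.map (CommRingCat.ofHom (algebraMap R₁ B₁))
  rw [← Spec.map_comp, ← CommRingCat.ofHom_comp]
  congr 2
  ext s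
  change algEquivOfIsBaseChange π hπ (s ⊗ₜ 1) = algebraMap R₁ B₁ s
  rw [algEquivOfIsBaseChange_tmul, map_one, Algebra.smul_def, mul_one]

variable [Algebra ℂ B] [IsScalarTower ℂ R B] [IsScalarTower ℂ R B₁]

/-- `Spec B₁ ≅ Spec (R₁ ⊗_R B) → Spec B` is `Spec π`. [folklore] -/
theorem specIsoOfIsBaseChange_hom_inr :
    (specIsoOfIsBaseChange π hπ).hom ≫ specOverOfAlgHom (tensorInr R R₁ B) =
      specOverOfAlgHom (π.restrictScalars ℂ) := by
  ext1
  change Spec.map (CommRingCat.ofHom ((algEquivOfIsBaseChange π hπ).restrictScalars ℂ).toRingEquiv.toRingHom) ≫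
      Spec.map (CommRingCat.ofHom (tensorInr R R₁ B).toRingHom) =
    Spec.map (CommRingCat.ofHom (π.restrictScalars ℂ).toRingHom)
  rw [← Spec.map_comp, ← CommRingCat.ofHom_comp]
  congr 2
  ext b
  change algEquivOfIsBaseChange π hπ (1 ⊗ₜ b) = π b
  rw [algEquivOfIsBaseChange_tmul, one_smul]

/-- **`(Spec B₁)(ℂ) ≃ₜ (Spec R₁)(ℂ) ×_{(Spec R)(ℂ)} (Spec B)(ℂ)` for a base change `B₁ ≅ R₁ ⊗_R B`.**
[cite: ConradAdelicPoints2012, Prop. 2.1] -/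
def baseChangePointsHomeomorph :
    Motives.ComplexPoints (specOver ℂ B₁) ≃ₜ
      {p : Motives.ComplexPoints (specOver ℂ R₁) × Motives.ComplexPoints (specOver ℂ B) //
        AlgPoints.map (specOverOfAlgHom (IsScalarTower.toAlgHom ℂ R R₁)) p.1 =
          AlgPoints.map (specOverOfAlgHom (IsScalarTower.toAlgHom ℂ R B)) p.2} :=
  (pointsHomeomorphOfIso (specIsoOfIsBaseChange π hπ)).trans (tensorPointsHomeomorph R R₁ B)

omit [IsScalarTower ℂ R B₁] in
/-- First component of `baseChangePointsHomeomorph`: the structure map to `(Spec R₁)(ℂ)`.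
[folklore] -/
@[simp] theorem baseChangePointsHomeomorph_apply_fst (P : Motives.ComplexPoints (specOver ℂ B₁)) :
    ((baseChangePointsHomeomorph π hπ P).1).1 =
      AlgPoints.map (specOverOfAlgHom (IsScalarTower.toAlgHom ℂ R₁ B₁)) P := by
  rw [← specIsoOfIsBaseChange_hom_inl π hπ, AlgPoints.map_comp_apply]
  exact tensorPointsHomeomorph_apply_fst R R₁ B _

/-- Second component of `baseChangePointsHomeomorph`: `Spec π`. [folklore] -/
@[simp] theorem baseChangePointsHomeomorph_apply_snd (P : Motives.ComplexPoints (specOver ℂ B₁)) :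
    ((baseChangePointsHomeomorph π hπ P).1).2 =
      AlgPoints.map (specOverOfAlgHom (π.restrictScalars ℂ)) P := by
  rw [← specIsoOfIsBaseChange_hom_inr π hπ, AlgPoints.map_comp_apply]
  exact tensorPointsHomeomorph_apply_snd R R₁ B _

include hπ in
/-- Two complex points of `Spec B₁` with the same images in `(Spec R₁)(ℂ)` and `(Spec B)(ℂ)` are
equal. [folklore] -/
theorem baseChangePoints_ext {P Q : Motives.ComplexPoints (specOver ℂ B₁)}
    (h₁ : AlgPoints.map (specOverOfAlgHom (IsScalarTower.toAlgHom ℂ R₁ B₁)) P =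
      AlgPoints.map (specOverOfAlgHom (IsScalarTower.toAlgHom ℂ R₁ B₁)) Q)
    (h₂ : AlgPoints.map (specOverOfAlgHom (π.restrictScalars ℂ)) P =
      AlgPoints.map (specOverOfAlgHom (π.restrictScalars ℂ)) Q) : P = Q := by
  apply (baseChangePointsHomeomorph π hπ).injective
  ext1
  exact Prod.ext (by simpa using h₁) (by simpa using h₂)

include hπ in
/-- Every compatible pair in `(Spec R₁)(ℂ) × (Spec B)(ℂ)` comes from a complex point of `Spec B₁`.
[folklore] -/
theorem exists_baseChangePoint (a : Motives.ComplexPoints (specOver ℂ R₁))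
    (b : Motives.ComplexPoints (specOver ℂ B))
    (h : AlgPoints.map (specOverOfAlgHom (IsScalarTower.toAlgHom ℂ R R₁)) a =
      AlgPoints.map (specOverOfAlgHom (IsScalarTower.toAlgHom ℂ R B)) b) :
    ∃ P : Motives.ComplexPoints (specOver ℂ B₁),
      AlgPoints.map (specOverOfAlgHom (IsScalarTower.toAlgHom ℂ R₁ B₁)) P = a ∧
        AlgPoints.map (specOverOfAlgHom (π.restrictScalars ℂ)) P = b := by
  refine ⟨(baseChangePointsHomeomorph π hπ).symm ⟨(a, b), h⟩, ?_, ?_⟩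
  · rw [← baseChangePointsHomeomorph_apply_fst π hπ, Homeomorph.apply_symm_apply]
  · rw [← baseChangePointsHomeomorph_apply_snd π hπ, Homeomorph.apply_symm_apply]

end BaseChangePoints

end Literature.AlgebraicGeometry.FundamentalGroup

end
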